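import Mathlib
import HarnessLib
import Summits.ValiantsHypothesis.ValiantsHypothesis.Theses.MonotoneRestoration
import Literature.Computability.AlgebraicComplexity.ArithCircuit
import Literature.Computability.AlgebraicComplexity.ArithCircuitProofs
import Literature.Computability.AlgebraicComplexity.MonotoneStructure
import Literature.Computability.AlgebraicComplexity.PermanentIrreducible
import Literature.ModelTheory.FiniteModelTheory.CkEquiv
import Summits.ValiantsHypothesis.ValiantsHypothesis.Theorems.MonotoneRestorationMonotoneRestorationQPCosetCount
import Summits.ValiantsHypothesis.ValiantsHypothesis.Theorems.MonotoneRestorationMonotoneRestorationQPSymmetricLB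
import Summits.ValiantsHypothesis.ValiantsHypothesis.Theorems.MonotoneRestorationMonotoneRestorationQPSupportSymmetrisation
import Summits.ValiantsHypothesis.ValiantsHypothesis.Theorems.MonotoneRestorationMonotoneRestorationQPSparseRegime
import Summits.ValiantsHypothesis.ValiantsHypothesis.Theorems.MonotoneRestorationMonotoneRestorationQPBeta
import Literature.Computability.AlgebraicComplexity.SymmetricArithCircuit
import Literature.Computability.AlgebraicComplexity.DawarWilsenach2025Proofs
import Literature.GroupTheory.PermutationGroups.SmallIndexSubgroups
import Summits.ValiantsHypothesis.ValiantsHypothesis.Theorems.MonotoneRestorationQP.Negative.LoadBearing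
import Summits.ValiantsHypothesis.ValiantsHypothesis.Theorems.MonotoneRestorationMonotoneRestorationQPPermSupportCount

/-! TTRL-lite variant V20083 of stmt-ValiantsHypothesis-15886 -/

-- (Sub = Summit), so the duplicated namespace component is intended.
set_option linter.dupNamespace false

namespace Summit.ValiantsHypothesis.ValiantsHypothesis.Theorems

open Summit.ValiantsHypothesis.ValiantsHypothesis.Theses.MonotoneRestoration
open Literature.Computability.AlgebraicComplexity

/-- **Variable-counting floor.** If every variable of a finite set `S` labels some gate of a
labelled arithmetic circuit on the gate type `G`, then `|S| ≤ |G|`: labels are a function of the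
gate, so gates carrying distinct variable labels are distinct, and choosing one gate per variable
of `S` is an injection `S ↪ G`. (TTRL-lite variant V20083 of `stmt-ValiantsHypothesis-15886`.) -/
theorem stub_symmetricMonotone_choose_le_card_var20083 :
    ∀ (n : ℕ) (G : Type) [Fintype G] (C : LabelledArithCircuit NNReal (Fin n × Fin n) Unit G)
      (S : Finset (Fin n × Fin n)), (∀ p ∈ S, ∃ g : G, C.label g = CircuitLabel.var p) →
      S.card ≤ Fintype.card G := by
  intro n G _ C S hS
  classical
  choose f hf using hS
  have hinj : Function.Injective (fun p : S => f p.1 p.2) := by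
    rintro ⟨p, hp⟩ ⟨q, hq⟩ h
    have hpq : (CircuitLabel.var p : CircuitLabel NNReal (Fin n × Fin n)) = CircuitLabel.var q := by
      rw [← hf p hp, ← hf q hq]
      exact congrArg C.label h
    cases hpq
    rfl
  simpa using Fintype.card_le_of_injective _ hinj

end Summit.ValiantsHypothesis.ValiantsHypothesis.Theorems
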